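import Summits.BirchSwinnertonDyer.Rank1Residual.Additive.TameThreeShapeBrackets
import Summits.BirchSwinnertonDyer.Rank1Residual.Additive.SelectorIdentityTameThreeHolds
import Summits.BirchSwinnertonDyer.Rank1Residual.Additive.LocIrrThreeTameCubeHolds
import Mathlib.NumberTheory.Padics.HeightOneSpectrum
import Mathlib.NumberTheory.Padics.RingHoms
import HarnessLib

/-!
# L-O6-irr is an EQUIVALENCE on the tame cell (t′) at `3` (Kodaira III / III*, census cell O5b):
# `LocIrr W 3 ↔ Δ′ ≡ ±1 (mod 9) ↔ Δ_min ∈ (ℚ₃^{nr×})³` — the converse of L-O6-irr, UNCONDITIONALLY,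
# from Tate's Step-4 / Step-9 normal forms, a residue map `𝒪_v → ℤ/9`, and the selector identity
# (cell `b2b-bsdres`; seat `b2b-bsdres-x11b3-p7` GEN 8 as CROSS-CELL POOL HAND — harvest-2 GEN 37 E83
#  §4 (c) "LocIrr ⟺ Δ̃ ≡ ±1 (mod 9), 36 323 / 36 323 … prover to check" and
#  `Additive/UnitPartModNineTameFour.lean` "the bridge to `minimalDiscUnitPartThree` is the prover's pen";
#  theorems only)

HONEST FRAMING (cell `b2b-bsdres`, run/shared/lean/b2b/bsd-rank1-residual/, verbatim in every file): the
goal of the cell is to DELETE the COMBINATION-SHAPED residual classes of the Birch–Swinnerton-Dyer formula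
for ALL analytic-rank `≤ 1` elliptic curves over `ℚ` — "full BSD formula for every rank `≤ 1` curve in
class `C`" assembled STRICTLY from published theorems — so that the rank-`≤ 1` remainder becomes exactly
the CONSTRUCTION-SHAPED classes, which are TYPED (missing-input `Prop`s), NOT attempted. This is not
"finishing BSD". Lane CLASS-CLOSURE / teams o5–o6 (O5 OPEN): research routes; census output is
EVIDENCE, never a Literature fact; nothing is booked; no mark of `RESIDUAL-MAP.md` moves. This file:
THEOREMS ONLY (no definition, no named fact, no `@[conjecture]` node, no `sorry`; net named-fact debt
`0`). NO hypothesis beyond `Addv W 3` / `SubTprime W 3` (resp. `ClassO5 W 3`).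

## What is proved

* **`locIrr_three_of_isPmOneModNine_of_subTprime (hadd : Addv W 3) (hT : SubTprime W 3)
  (hD : IsPmOneModNine (minimalDiscUnitPartThree W)) : LocIrr W 3`** — the CONVERSE of L-O6-irr on
  (t′): `Δ′ ≡ ±1 (mod 9)` forces `E[3]|G_{ℚ₃}` irreducible.
* **`locIrr_three_iff_isPmOneModNine_of_subTprime : LocIrr W 3 ↔ IsPmOneModNine (minimalDiscUnitPartThree W)`**
  (⟹ = L-O6-irr `isPmOneModNine_minimalDiscUnitPartThree_of_locIrr`, `Additive/LocIrrThreeTameCubeHolds.lean`,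
  x11b3-p7 GEN 7), **`locIrr_three_iff_minimalDiscIsCubeUnramifiedThree_of_subTprime :
  LocIrr W 3 ↔ MinimalDiscIsCubeUnramifiedThree W`** (cc-typer-5's "`Δ_min` is a cube in `ℚ₃^{nr}`",
  `Additive/LocIrrThreeCriteria.lean`), and the class form `locIrr_three_iff_isPmOneModNine_of_classO5`
  (`ClassO5 W 3 → SubTprime W 3 → …`, the binders of the O5b statements).

ROUTE of the converse (elementary; no table, no named fact): (t′) ⟺ Kodaira III / III*
(`subTprime_three_iff_kodairaSymbolAt_III_or_IIIstar`); Tate's normal form `N = C • E` over `ℚ₃ = K_v`,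
`v = (3)` (`exists_variableChange_b_of_kodairaSymbolAt_eq_III` / `_eq_IIIstar`, bsd.S15) with
`Δ(N) = 3^e δ`, `e = v₃Δ_min ∈ {3, 9}`; the brackets of `Additive/TameThreeShapeBrackets.lean`:
`β₄ ∈ 𝒪^×`, `4δ = −32β₄³ + 3β₂²β₄² + 9(…)`; the scaling `u = C.u` is a `3`-adic unit with `Δ′ = u¹²δ`
(`Δ(N) = u⁻¹²Δ_min`, `Δ_min = 3^e Δ′`, `3 ∤ Δ′`); through a residue map `𝒪_v ≃ ℤ₃ → ℤ/9` (Mathlib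
`adicCompletion.padicEquiv`, `PadicInt.toZModPow 2` — the pattern of
`Additive/CondExpFourUnitPartLawThreeHolds.lean`) a UNIT `β₂` would give `4Δ′ ≡ −32a³ + 3`, `a⁶ = 1`,
i.e. `Δ′ ∈ {4, 2} (mod 9)` (`decide` in `ℤ/9`), contradicting `Δ′ ≡ ±1`; so `β₂ ∈ 3𝒪`, whence
`v₃(c₆(E)) ≥ m + 2` (`c₆(N) = u⁻⁶c₆(E)`, second bracket), i.e. EITHER `c₆ = 0` — then `c₄ ≠ 0` and
`LocIrr` by `locIrr_three_of_c₆_eq_zero'` (L-O56-sel, harvest-2 E89) — OR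
`v₃(j − 1728) = 2v₃(c₆) − v₃(Δ) ≥ 2m + 4 − e = 7`, and `LocIrr` by the selector identity
`locIrr_three_iff_seven_le_of_subTprime` (`Additive/SelectorIdentityTameThreeHolds.lean`).
LINK TO PRINT: Conrad–Diamond–Taylor, JAMS 12 (1999), proof of Thm 7.2.1 (p. 553): for these `e = 4`
curves, if `E[3]|G_{ℚ₃}` is reducible "one can compute this splitting field to be `ℚ₃(√−3, Δ^{1/3})`,
which is peu-ramifié because `3 ∣ v₃(Δ)`"; the theorem says conversely that `Δ` a cube in `ℚ₃^{nr}`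
(`3 ∣ v₃Δ` and `Δ′ ≡ ±1 (mod 9)`) only happens on the irreducible rows.
WORDING (EVIDENCE framing; cc-typer-5 / the o5–o6 planners rule on `TYPED.md` / `TARGETS.md`): "on O5b
(= (t′) at `3`), `LocIrr(3)` ⟺ `Δ′ ≡ ±1 (mod 9)` ⟺ `MinimalDiscIsCubeUnramifiedThree` is a THEOREM; the
census 36 323 / 36 323 (harvest-2 `gen37/src/dtilde_check.py`) stays EVIDENCE; nothing booked; no mark;
O5 OPEN." NOT here: the wild cell (there L-O6-cyc9 shows the cube condition FAILS on `f₃ = 4`); `p ≠ 3`.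

References: J. H. Silverman, *Advanced Topics in the Arithmetic of Elliptic Curves*, GTM 151 (1994),
IV.9.4 Steps 4, 9, Table 4.1 [SilvermanATAEC1994]; B. Conrad, F. Diamond, R. Taylor, J. Amer. Math.
Soc. 12 (1999), proof of Thm. 7.2.1 (p. 553) [ConradDiamondTaylor1999]; J.-P. Serre, Invent. Math. 15
(1972) §5.3 [SerreInventiones1972]; cell files `b2b-bsdres-harvest-2/gen37/E83-L-O5-G3-1-locators.md`
§4 (b)–(c), `cells/o5o6/TARGETS.md` §O5.
-/

noncomputable section

open scoped Classical

open WeierstrassCurve IsDedekindDomain IsDedekindDomain.HeightOneSpectrum WithZero Rat.HeightOneSpectrum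
  Literature.NumberTheory.EllipticCurves Literature.NumberTheory.EllipticCurves.Rank1Residual
  Literature.NumberTheory.EllipticCurves.Rank1Residual.Typed Literature.NumberTheory.DiophantineGeometry

namespace Summit.BirchSwinnertonDyer.Rank1Residual.Additive


/-! ## §1 Arithmetic in `ℤ/9` and units of `𝒪_v` (`v = (3)` of `ℤ`) -/

section NineArith

/-- Units of `ℤ/9` satisfy `x⁶ = 1` (`φ(9) = 6`). [folklore] -/
private theorem pow_six_eq_one_of_isUnit' {x : ZMod 9} (hx : IsUnit x) : x ^ 6 = 1 := by
  obtain ⟨u, rfl⟩ := hx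
  have h := ZMod.pow_totient u
  have h9 : Nat.totient 9 = 6 := by
    rw [show (9 : ℕ) = 3 ^ 2 by norm_num, Nat.totient_prime_pow Nat.prime_three (by norm_num)]
    norm_num
  rw [h9] at h
  have h' := congrArg Units.val h
  simpa [Units.val_pow_eq_pow_val] using h'

/-- Cubes of units of `ℤ/9` are `±1`. [folklore] -/
private theorem zmod_nine_cube' : ∀ a : ZMod 9, a ^ 6 = 1 → a ^ 3 = 1 ∨ a ^ 3 = 8 := by decide

/-- `3b²a² = 3` for units `a, b` of `ℤ/9`. [folklore] -/
private theorem zmod_nine_three_mul_sq_sq : ∀ a b : ZMod 9, a ^ 6 = 1 → b ^ 6 = 1 →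
    3 * b ^ 2 * a ^ 2 = 3 := by decide

/-- `4d = −32c + 3` with `c = ±1` forces `d ∉ {1, 8}` in `ℤ/9` (`d ∈ {4, 2}`). [folklore] -/
private theorem zmod_nine_final' : ∀ c d : ZMod 9, (c = 1 ∨ c = 8) → 4 * d = -32 * c + 3 →
    d ≠ 1 ∧ d ≠ 8 := by decide

/-- The arithmetic kernel: for units `a, b` of `ℤ/9` and `4d = −32a³ + 3b²a²`, `d ∉ {1, 8}` — on the
generic rows (`β₂` a unit) `Δ′ ≡ u³ + 3 ≢ ±1 (mod 9)`. [folklore] -/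
private theorem zmod_nine_key' (a b d : ZMod 9) (ha : a ^ 6 = 1) (hb : b ^ 6 = 1)
    (hd : 4 * d = -32 * a ^ 3 + 3 * b ^ 2 * a ^ 2) : d ≠ 1 ∧ d ≠ 8 := by
  rw [zmod_nine_three_mul_sq_sq a b ha hb] at hd
  exact zmod_nine_final' (a ^ 3) d (zmod_nine_cube' a ha) hd

/-- A unit of `𝒪_v` has valuation `1`. [folklore] -/
private theorem valued_eq_one_of_isUnit'' {x : (placeOf 3).adicCompletionIntegers ℚ} (hx : IsUnit x) :
    Valued.v (x : (placeOf 3).adicCompletion ℚ) = 1 := by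
  obtain ⟨y, hy⟩ := hx.exists_right_inv
  have h1 : Valued.v (x : (placeOf 3).adicCompletion ℚ) *
      Valued.v (y : (placeOf 3).adicCompletion ℚ) = 1 := by
    rw [← map_mul, ← Subring.coe_mul, hy]; simp
  refine le_antisymm x.2 ?_
  calc (1 : ℤᵐ⁰) = _ := h1.symm
    _ ≤ Valued.v (x : (placeOf 3).adicCompletion ℚ) * 1 := mul_le_mul' le_rfl y.2
    _ = _ := mul_one _

/-- In `ℤᵐ⁰`: `x ^ n = 1` with `n ≠ 0` forces `x = 1`. [folklore] -/
private theorem eq_one_of_pow_eq_one'' {x : ℤᵐ⁰} {n : ℕ} (hn : n ≠ 0) (h : x ^ n = 1) : x = 1 := by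
  rcases lt_trichotomy x 1 with hlt | heq | hgt
  · exact absurd h (pow_lt_one' hlt hn).ne
  · exact heq
  · exact absurd h (one_lt_pow' hgt hn).ne'

/-- An element of `𝒪_v` of valuation `1` is a unit. [folklore] -/
private theorem isUnit_of_valued_eq_one' {x : (placeOf 3).adicCompletionIntegers ℚ}
    (hx : Valued.v (x : (placeOf 3).adicCompletion ℚ) = 1) : IsUnit x := by
  have hx0 : (x : (placeOf 3).adicCompletion ℚ) ≠ 0 := fun h ↦ by
    rw [h, map_zero] at hx; exact zero_ne_one hx
  let y : (placeOf 3).adicCompletionIntegers ℚ :=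
    ⟨(x : (placeOf 3).adicCompletion ℚ)⁻¹, by
      rw [mem_adicCompletionIntegers, map_inv₀, hx, inv_one]⟩
  exact isUnit_iff_exists_inv.mpr ⟨y, Subtype.ext (mul_inv_cancel₀ hx0)⟩

/-- A residue map `𝒪_v →+* ℤ/9` (`𝒪_v ≃ ℤ₃ → ℤ/9`, Mathlib `adicCompletion.padicEquiv`,
`PadicInt.toZModPow 2`). [folklore] -/
private theorem nonempty_ringHom_zmod_nine :
    Nonempty ((placeOf 3).adicCompletionIntegers ℚ →+* ZMod 9) := by
  let p3 : Nat.Primes := primesEquiv (R := ℤ) (placeOf 3)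
  haveI : Fact (Nat.Prime (p3 : ℕ)) := ⟨p3.2⟩
  have hp3 : (p3 : ℕ) = 3 :=
    congrArg Subtype.val ((primesEquiv (R := ℤ)).apply_symm_apply ⟨3, Nat.prime_three⟩)
  have h9 : 9 ∣ (p3 : ℕ) ^ 2 := by rw [hp3]; norm_num
  have hbij := adicCompletion.padicEquiv_bijOn (R := ℤ) (placeOf 3)
  let ρ : (placeOf 3).adicCompletionIntegers ℚ →+* ℤ_[p3] :=
    ((adicCompletion.padicEquiv (R := ℤ) (placeOf 3)).toRingHom.comp
      ((placeOf 3).adicCompletionIntegers ℚ).subtype).codRestrict (PadicInt.subring p3)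
      (fun x => hbij.mapsTo x.2)
  exact ⟨(ZMod.castHom h9 (ZMod 9)).comp ((PadicInt.toZModPow 2).comp ρ)⟩

end NineArith

/-! ## §2 The equivalence on (t′) at `3` -/

section Curves

variable (W : WeierstrassCurve ℚ) [W.IsElliptic] [W.IsGloballyMinimal]

/-- **The converse of L-O6-irr on the tame cell, UNCONDITIONALLY.** For `W/ℚ` elliptic and globally
minimal, additive at `3` (`Addv W 3`) and in (t′) (`SubTprime W 3`, i.e. Kodaira III / III*): if the unit
part of the minimal discriminant satisfies `Δ′ ≡ ±1 (mod 9)` then `E[3]|G_{ℚ₃}` is irreducible. Route: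
Tate's Step-4 / Step-9 normal form `N = C • E` over `ℚ₃` (bsd.S15); the brackets file gives `β₄ ∈ 𝒪^×` and
`4δ = −32β₄³ + 3β₂²β₄² + 9(…)`; `u = C.u` is a `3`-adic unit with `Δ′ = u¹²δ`; through a residue map
`𝒪_v → ℤ/9`, a UNIT `β₂` would give `Δ′ ≡ u¹²(β₄³ + 3) ≢ ±1` (`zmod_nine_key'`) — so `β₂ ∈ 3𝒪`, whence
`v₃(c₆) ≥ m + 2` (`Additive/TameThreeShapeBrackets.lean`; `c₆` is a weight-6 invariant up to the unit `u⁶`),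
i.e. `c₆ = 0` (then `LocIrr` by
`locIrr_three_of_c₆_eq_zero'`) or `v₃(j − 1728) = 2v₃(c₆) − v₃(Δ) ≥ 7` (then `LocIrr` by the selector
identity `locIrr_three_iff_seven_le_of_subTprime`). No table, no named fact.
[cite: SilvermanATAEC1994, IV.9.4 Steps 4 and 9, Table 4.1] -/
theorem locIrr_three_of_isPmOneModNine_of_subTprime (hadd : Addv W 3) (hT : SubTprime W 3)
    (hD : IsPmOneModNine (minimalDiscUnitPartThree W)) : LocIrr W 3 := by
  haveI : PerfectField (IsLocalRing.ResidueField ((placeOf 3).adicCompletionIntegers ℚ)) :=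
    PerfectField.ofFinite
  have h2 : ringChar (ℤ ⧸ (placeOf 3).asIdeal) ≠ 2 := by rw [ringChar_int_quot_placeOf 3]; decide
  have hgen : natGenerator (placeOf 3) = 3 :=
    Literature.NumberTheory.EllipticCurves.Rat.natGenerator_primesEquiv_symm ⟨3, Nat.prime_three⟩
  have hπ : (placeOf 3).valuation ℚ (3 : ℚ) = exp (-1 : ℤ) := by
    have h := valuation_natGenerator_int (placeOf 3)
    rwa [hgen, Nat.cast_ofNat] at h
  have h3 : algebraMap ℚ ((placeOf 3).adicCompletion ℚ) 3 = 3 := map_ofNat _ 3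
  -- Kodaira type, `v₃Δ_min = e ∈ {3, 9}`, `m ∈ {3, 6}`
  have hK := (subTprime_three_iff_kodairaSymbolAt_III_or_IIIstar (W := W) hadd).mp hT
  have hΔ39 := padicValRat_Δ_eq_of_kodairaSymbolAt_III_or_IIIstar W hK
  -- the unit part `Δ′` and `Δ_min = 3^v Δ′`, `3 ∤ Δ′`
  set D' := minimalDiscUnitPartThree W with hD'
  set vD := padicValInt 3 W.minimalDiscriminantInt with hvD
  have hDmin : W.minimalDiscriminantInt = 3 ^ vD * D' := minimalDiscriminantInt_eq_pow_mul_unitPart W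
  have hD0 : W.minimalDiscriminantInt ≠ 0 := minimalDiscriminantInt_ne_zero W
  have hD'3 : ¬ (3 : ℤ) ∣ D' := by
    rintro ⟨d, hd⟩
    have h3 : (3 : ℤ) ^ (vD + 1) ∣ W.minimalDiscriminantInt := ⟨d, by rw [hDmin, hd]; ring⟩
    rcases (padicValInt_dvd_iff (p := 3) _ _).mp (by exact_mod_cast h3) with h | h
    · exact hD0 h
    · omega
  -- shapes on a `ℚ₃`-model, uniformly in the two types
  obtain ⟨C, β₂, β₄, β₆, δ, e, m, hδ, hβ₄, hid, hc₆le, hΔN, he, hem⟩ :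
      ∃ (C : VariableChange ((placeOf 3).adicCompletion ℚ)) (β₂ β₄ β₆ δ : (placeOf 3).adicCompletionIntegers ℚ)
        (e m : ℕ),
        IsUnit δ ∧ Valued.v (β₄ : (placeOf 3).adicCompletion ℚ) = 1 ∧
        (4 * (δ : (placeOf 3).adicCompletion ℚ) =
          -32 * (β₄ : (placeOf 3).adicCompletion ℚ) ^ 3 +
            3 * (β₂ : (placeOf 3).adicCompletion ℚ) ^ 2 * (β₄ : (placeOf 3).adicCompletion ℚ) ^ 2 +
            9 * (-(β₂ : (placeOf 3).adicCompletion ℚ) ^ 3 * β₆ - 36 * (β₆ : (placeOf 3).adicCompletion ℚ) ^ 2 +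
              12 * β₂ * β₄ * β₆)) ∧
        (Valued.v (β₂ : (placeOf 3).adicCompletion ℚ) ≤ exp (-1 : ℤ) →
          Valued.v (C • W.baseChange ((placeOf 3).adicCompletion ℚ)).c₆ ≤ exp (-((m : ℤ) + 2))) ∧
        (C • W.baseChange ((placeOf 3).adicCompletion ℚ)).Δ = algebraMap ℚ ((placeOf 3).adicCompletion ℚ) 3 ^ e * δ ∧
        padicValRat 3 W.Δ = e ∧ 2 * (m : ℤ) + 4 = e + 7 := by
    rcases hK with hK3 | hK9
    · obtain ⟨C, β₂, β₄, β₆, δ, hδ, hb₂, hb₄, hb₆, hΔ⟩ :=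
        W.exists_variableChange_b_of_kodairaSymbolAt_eq_III (placeOf 3) h2 hK3 hπ
      obtain ⟨hβ₄, hid⟩ := valued_δ_bracket_of_tame_shape (placeOf 3) hπ h3 _ β₂ β₄ β₆ δ hδ
        hb₂ hb₄ hb₆ hΔ (Or.inl ⟨rfl, rfl, rfl, rfl⟩)
      exact ⟨C, β₂, β₄, β₆, δ, 3, 3, hδ, hβ₄, hid,
        fun hβ₂ ↦ valued_c₆_le_of_tame_shape_of_b₂ (placeOf 3) hπ h3 _ β₂ β₄ β₆ hb₂ hb₄ hb₆
          (Or.inl ⟨rfl, rfl, rfl, rfl⟩) hβ₂, hΔ, hΔ39.1 hK3, by norm_num⟩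
    · obtain ⟨C, β₂, β₄, β₆, δ, hδ, hb₂, hb₄, hb₆, hΔ⟩ :=
        W.exists_variableChange_b_of_kodairaSymbolAt_eq_IIIstar (placeOf 3) h2 hK9 hπ
      obtain ⟨hβ₄, hid⟩ := valued_δ_bracket_of_tame_shape (placeOf 3) hπ h3 _ β₂ β₄ β₆ δ hδ
        hb₂ hb₄ hb₆ hΔ (Or.inr ⟨rfl, rfl, rfl, rfl⟩)
      exact ⟨C, β₂, β₄, β₆, δ, 9, 6, hδ, hβ₄, hid,
        fun hβ₂ ↦ valued_c₆_le_of_tame_shape_of_b₂ (placeOf 3) hπ h3 _ β₂ β₄ β₆ hb₂ hb₄ hb₆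
          (Or.inr ⟨rfl, rfl, rfl, rfl⟩) hβ₂, hΔ, hΔ39.2 hK9, by norm_num⟩
  have hve : vD = e := by
    have := padicValRat_Δ_eq_padicValInt_minimalDiscriminantInt W
    rw [he] at this
    exact_mod_cast this.symm
  rw [h3] at hΔN
  have h3v : Valued.v (algebraMap ℚ ((placeOf 3).adicCompletion ℚ) 3) = exp (-1 : ℤ) :=
    (valuedAdicCompletion_eq_valuation' (placeOf 3) (3 : ℚ)).trans hπ
  rw [h3] at h3v
  have h30 : (3 : (placeOf 3).adicCompletion ℚ) ≠ 0 := fun h ↦ by rw [h, map_zero] at h3v; exact exp_ne_zero h3v.symm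
  -- `Δ′ = u¹² δ` with `u` the scaling of the model
  set u : ((placeOf 3).adicCompletion ℚ) := (C.u : (placeOf 3).adicCompletion ℚ) with hu
  have hu0 : u ≠ 0 := C.u.ne_zero
  have hΔQ : W.Δ = (3 : ℚ) ^ e * (D' : ℚ) := by
    rw [← cast_minimalDiscriminantInt W, hDmin, hve]; push_cast; ring
  have hWΔ : (W.baseChange ((placeOf 3).adicCompletion ℚ)).Δ =
      (3 : (placeOf 3).adicCompletion ℚ) ^ e * ((D' : ℤ) : (placeOf 3).adicCompletion ℚ) := by
    rw [show (W.baseChange ((placeOf 3).adicCompletion ℚ)).Δ = algebraMap ℚ ((placeOf 3).adicCompletion ℚ) W.Δ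
      from W.map_Δ _, hΔQ, map_mul, map_pow, h3, map_intCast]
  have hD'eq : ((D' : ℤ) : (placeOf 3).adicCompletion ℚ) =
      u ^ 12 * (δ : (placeOf 3).adicCompletion ℚ) := by
    have hC := (W.baseChange ((placeOf 3).adicCompletion ℚ)).variableChange_Δ C
    rw [hΔN, hWΔ, Units.val_inv_eq_inv_val, ← hu] at hC
    have h3e : (3 : (placeOf 3).adicCompletion ℚ) ^ e ≠ 0 := pow_ne_zero _ h30
    have : (3 : (placeOf 3).adicCompletion ℚ) ^ e * (u ^ 12 * (δ : (placeOf 3).adicCompletion ℚ)) =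
        (3 : (placeOf 3).adicCompletion ℚ) ^ e * ((D' : ℤ) : (placeOf 3).adicCompletion ℚ) := by
      rw [show (3 : (placeOf 3).adicCompletion ℚ) ^ e * (u ^ 12 * (δ : (placeOf 3).adicCompletion ℚ)) =
        u ^ 12 * (3 ^ e * δ) by ring, hC]
      field_simp
    exact (mul_left_cancel₀ h3e this).symm
  -- `u` is a `3`-adic unit
  have hwD' : Valued.v ((D' : ℤ) : (placeOf 3).adicCompletion ℚ) = 1 := by
    have hD'0 : D' ≠ 0 := fun h ↦ hD'3 (h ▸ dvd_zero 3)
    have hQ0 : ((D' : ℤ) : ℚ) ≠ 0 := Int.cast_ne_zero.mpr hD'0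
    have hcoe : Valued.v (algebraMap ℚ ((placeOf 3).adicCompletion ℚ) ((D' : ℤ) : ℚ)) =
        (placeOf 3).valuation ℚ ((D' : ℤ) : ℚ) :=
      valuedAdicCompletion_eq_valuation' (placeOf 3) ((D' : ℤ) : ℚ)
    rw [valuation_eq_exp_neg_padicValRat (placeOf 3) hQ0, hgen,
      padicValRat.of_int, padicValInt.eq_zero_of_not_dvd hD'3, map_intCast] at hcoe
    rw [hcoe]; simp
  have hwu : Valued.v u = 1 := by
    have hwδ := valued_eq_one_of_isUnit'' hδ
    have h := congrArg Valued.v hD'eq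
    rw [hwD', map_mul, map_pow, hwδ, mul_one] at h
    exact eq_one_of_pow_eq_one'' (by norm_num) h.symm
  -- Step 1: `β₂ ∈ 3𝒪` — a unit `β₂` contradicts `Δ′ ≡ ±1 (mod 9)`
  have hβ₂ : Valued.v (β₂ : (placeOf 3).adicCompletion ℚ) ≤ exp (-1 : ℤ) := by
    by_contra hnot
    have hβ₂1 : Valued.v (β₂ : (placeOf 3).adicCompletion ℚ) = 1 := by
      refine le_antisymm β₂.2 (le_of_not_gt fun hlt ↦ ?_)
      have := ThreeAdicLift.le_exp_sub_one_of_lt_exp (n := 0) (by rwa [exp_zero])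
      exact hnot (by rwa [show (0 : ℤ) - 1 = -1 by norm_num] at this)
    -- pass to `𝒪_v` and to `ℤ/9`
    let uO : (placeOf 3).adicCompletionIntegers ℚ := ⟨u, by rw [mem_adicCompletionIntegers]; exact hwu.le⟩
    have huO : (uO : (placeOf 3).adicCompletion ℚ) = u := rfl
    have hO1 : ((D' : ℤ) : (placeOf 3).adicCompletionIntegers ℚ) = uO ^ 12 * δ := by
      apply Subtype.ext
      push_cast
      rw [huO, hD'eq]
    have hO2 : (4 : (placeOf 3).adicCompletionIntegers ℚ) * δ =
        ((-32 : ℤ) : (placeOf 3).adicCompletionIntegers ℚ) * β₄ ^ 3 +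
          ((3 : ℤ) : (placeOf 3).adicCompletionIntegers ℚ) * β₂ ^ 2 * β₄ ^ 2 +
          ((9 : ℤ) : (placeOf 3).adicCompletionIntegers ℚ) *
            (-β₂ ^ 3 * β₆ - ((36 : ℤ) : (placeOf 3).adicCompletionIntegers ℚ) * β₆ ^ 2 +
              ((12 : ℤ) : (placeOf 3).adicCompletionIntegers ℚ) * β₂ * β₄ * β₆) := by
      have cn : ∀ n : ℕ, [n.AtLeastTwo] →
          ((OfNat.ofNat n : (placeOf 3).adicCompletionIntegers ℚ) : (placeOf 3).adicCompletion ℚ) = OfNat.ofNat n :=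
        fun n _ ↦ map_ofNat ((placeOf 3).adicCompletionIntegers ℚ).subtype n
      apply Subtype.ext
      push_cast
      rw [cn 4, cn 32, cn 3, cn 9, cn 36, cn 12, hid]
    obtain ⟨φ⟩ := nonempty_ringHom_zmod_nine
    have hφ1 := congrArg φ hO1
    have hφ2 := congrArg φ hO2
    simp only [map_intCast, map_mul, map_pow, map_sub, map_add, map_neg, map_ofNat] at hφ1 hφ2
    push_cast at hφ1 hφ2
    rw [show (9 : ZMod 9) = 0 by decide, zero_mul, add_zero] at hφ2
    have c1 : φ uO ^ 12 = 1 := by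
      rw [show (12 : ℕ) = 6 * 2 from rfl, pow_mul,
        pow_six_eq_one_of_isUnit' ((isUnit_of_valued_eq_one' (x := uO) hwu).map φ), one_pow]
    have c2 : φ β₄ ^ 6 = 1 := pow_six_eq_one_of_isUnit' ((isUnit_of_valued_eq_one' (x := β₄) hβ₄).map φ)
    have c3 : φ β₂ ^ 6 = 1 := pow_six_eq_one_of_isUnit' ((isUnit_of_valued_eq_one' (x := β₂) hβ₂1).map φ)
    rw [c1, one_mul] at hφ1
    obtain ⟨k1, k8⟩ := zmod_nine_key' (φ β₄) (φ β₂) (φ δ) c2 c3 hφ2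
    rw [isPmOneModNine_iff_zmod, hφ1] at hD
    rcases hD with h | h
    · exact k1 h
    · exact k8 h
  -- Step 2: `v₃(c₆) ≥ m + 2` on `W` (the scaling `u` is a unit)
  have hc₆N := hc₆le hβ₂
  have hc₆W : Valued.v (algebraMap ℚ ((placeOf 3).adicCompletion ℚ) W.c₆) ≤ exp (-((m : ℤ) + 2)) := by
    have hC := (W.baseChange ((placeOf 3).adicCompletion ℚ)).variableChange_c₆ C
    rw [show (W.baseChange ((placeOf 3).adicCompletion ℚ)).c₆ = algebraMap ℚ ((placeOf 3).adicCompletion ℚ) W.c₆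
      from W.map_c₆ _, Units.val_inv_eq_inv_val, ← hu] at hC
    have : algebraMap ℚ ((placeOf 3).adicCompletion ℚ) W.c₆ =
        u ^ 6 * (C • W.baseChange ((placeOf 3).adicCompletion ℚ)).c₆ := by
      rw [hC]; field_simp
    rw [this, map_mul, map_pow, hwu, one_pow, one_mul]
    exact hc₆N
  -- Step 3: conclude
  by_cases hc6 : W.c₆ = 0
  · have hΔne : W.Δ ≠ 0 := by rw [← W.coe_Δ']; exact W.Δ'.ne_zero
    have hc4 : W.c₄ ≠ 0 := by
      intro hc4
      have h := W.c_relation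
      rw [hc4, hc6] at h
      have : (1728 : ℚ) * W.Δ = 0 := by linear_combination h
      exact hΔne (by simpa using this)
    exact locIrr_three_of_c₆_eq_zero' W hc4 hc6
  · have hj : W.j ≠ 1728 := by
      intro hj
      have hΔne : W.Δ ≠ 0 := by rw [← W.coe_Δ']; exact W.Δ'.ne_zero
      have h := j_sub_eq_c₆_sq_div_Δ W
      rw [hj, sub_self, eq_comm, div_eq_zero_iff] at h
      exact hc6 (pow_eq_zero_iff two_ne_zero |>.mp (h.resolve_right hΔne))
    refine (locIrr_three_iff_seven_le_of_subTprime W hadd hT hj).mpr ?_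
    have hvc6 : ((m : ℤ) + 2) ≤ padicValRat 3 W.c₆ := by
      have hcoe : Valued.v (algebraMap ℚ ((placeOf 3).adicCompletion ℚ) W.c₆) = (placeOf 3).valuation ℚ W.c₆ :=
        valuedAdicCompletion_eq_valuation' (placeOf 3) W.c₆
      rw [hcoe, valuation_eq_exp_neg_padicValRat (placeOf 3) hc6, hgen, exp_le_exp] at hc₆W
      omega
    rw [padicValRat_j_sub_eq W hc6, he]
    omega

/-- **L-O6-irr is an EQUIVALENCE on the tame cell (t′) at `3`** — the `Δ′ ≡ ±1 (mod 9)` form: for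
`W/ℚ` elliptic, globally minimal, additive at `3`, Kodaira III / III* (`SubTprime W 3`):
`LocIrr W 3 ↔ Δ′ ≡ ±1 (mod 9)`. (⟹) is L-O6-irr (`isPmOneModNine_minimalDiscUnitPartThree_of_locIrr`,
every curve); (⟸) is `locIrr_three_of_isPmOneModNine_of_subTprime`. This is the curve-level bridge that
harvest-2 GEN 37's `UnitPartModNineTameFour` (FK-model arithmetic, EVIDENCE 36 323 / 36 323) left to "the
prover's pen"; with Conrad–Diamond–Taylor's splitting-field sentence it reads: on O5b, `E[3]|G_{ℚ₃}` is
reducible iff `Δ_min` is NOT a cube in `ℚ₃^{nr}`. Census stays EVIDENCE; nothing booked; O5 OPEN; no mark.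
[cite: ConradDiamondTaylor1999, proof of Thm. 7.2.1 (p. 553)] -/
theorem locIrr_three_iff_isPmOneModNine_of_subTprime (hadd : Addv W 3) (hT : SubTprime W 3) :
    LocIrr W 3 ↔ IsPmOneModNine (minimalDiscUnitPartThree W) :=
  ⟨isPmOneModNine_minimalDiscUnitPartThree_of_locIrr W,
    locIrr_three_of_isPmOneModNine_of_subTprime W hadd hT⟩

/-- **L-O6-irr is an EQUIVALENCE on (t′) at `3`** — the cube form: `LocIrr W 3 ↔
MinimalDiscIsCubeUnramifiedThree W` (`3 ∣ v₃Δ_min ∧ Δ′ ≡ ±1 (mod 9)`, i.e. `Δ_min ∈ (ℚ₃^{nr×})³`); on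
(t′) `v₃Δ_min ∈ {3, 9}` so the divisibility conjunct is automatic. [folklore] -/
theorem locIrr_three_iff_minimalDiscIsCubeUnramifiedThree_of_subTprime (hadd : Addv W 3)
    (hT : SubTprime W 3) : LocIrr W 3 ↔ MinimalDiscIsCubeUnramifiedThree W := by
  refine ⟨fun hL ↦ locIrrThreeTameCube_holds W hL, fun h ↦ ?_⟩
  exact locIrr_three_of_isPmOneModNine_of_subTprime W hadd hT h.2

/-- The same on the class: `ClassO5 W 3 → SubTprime W 3 → (LocIrr W 3 ↔ Δ′ ≡ ±1 (mod 9))` (O5b =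
`ClassO5 ∧ SubTprime` supplies `Addv`). [folklore] -/
theorem locIrr_three_iff_isPmOneModNine_of_classO5 (hO : ClassO5 W 3) (hT : SubTprime W 3) :
    LocIrr W 3 ↔ IsPmOneModNine (minimalDiscUnitPartThree W) :=
  locIrr_three_iff_isPmOneModNine_of_subTprime W hO.2.1 hT

end Curves

end Summit.BirchSwinnertonDyer.Rank1Residual.Additive

end
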